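import Mathlib
import Summits.Ventures.HodgeRepro2.T5GaussianPlace
import Summits.Ventures.HodgeRepro2.T5EisensteinField

/-!
# A CONCRETE INERT PLACE: `ℚ(ζ₃)/ℚ` at `2` — `2` stays a uniformiser, and `f(η_v) = 0` (T5EisensteinInertPlace)

The third member of the family (T5GaussianPlace: wild ramified, `f = 2`; T5EisensteinPlace: tame ramified, `f = 1`).
`K = ℚ`, `L₃ = ℚ(ζ₃)` (T5EisensteinField), `v = v₂` the place of `ℚ` at `2` (T5GaussianField), `w` ANY place of
`L₃` above `v₂` (one exists: `exists_liesOver`). On Mathlib's completions `K_v ⊆ L_w`: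
* `[L_w : K_v] = 2` (`finrank_eq_two`: `X² + X + 1` has no root in `ℚ₂` — none in `ℤ/2`);
* THE PLACE IS INERT: `ϖ = 2` stays irreducible in `O_{L_w}` (`irreducible_algebraMap_two`). Proof: were the place
  ramified, row 171's integral basis `(1, π₀)` would write `ω = a + b π₀` with `a, b ∈ O_{K_v}`, and `ω² + ω + 1 = 0`
  would force `a² + a + 1 ∈ 𝔪_{K_v} = (2)`; through Mathlib's `adicCompletionIntegers.padicIntEquiv` (`O_{K_v} ≃ ℤ₂`)
  that is a root of `X² + X + 1` in `ℤ/2` — impossible;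
* there is `σ ≠ 1` in `Gal(L_w/K_v)`, and THE CONDUCTOR EXPONENT of the norm character is `f(η_v) = 0`
  (`normCharConductor_eq_zero`: every unit of `O_{K_v}` is a norm at an inert place, row 138) — the unramified value;
* `hypotheses_satisfiable`: the hypothesis set of the INERT files of the chain (`h2 · hϖ · hϖS · hσ`, the carriers of
  t6-p8's `N5Local_main_inert_completion`) holds on a concrete pair of number fields and places inside Mathlib.

No axiom beyond the standard trio; nothing of the scored record changes.
§8(d): uses an L-value-free non-vanishing device: NO.
-/

namespace Summit.Ventures.HodgeRepro2.T5EisensteinInertPlace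

open IsDedekindDomain HeightOneSpectrum NumberField
open Summit.Ventures.HodgeRepro2.T5GaussianField (v₂ primesEquiv_v₂ primesEquiv_v₂_val)
open Summit.Ventures.HodgeRepro2.T5EisensteinField

/-! ### `X² + X + 1` has no root in `ℚ₂` -/

/-- `X² + X + 1` has no root in `ℤ/2`. -/
theorem zmod_two_no_root : ∀ a : ZMod 2, a ^ 2 + a + 1 ≠ 0 := by decide

/-- `X² + X + 1` is never `≡ 0 (mod 2)`, in the form used below. -/
theorem zmod_two_no_root' : ∀ a b : ZMod 2, a ^ 2 + a + 1 ≠ 2 * b := by decide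

/-- `X² + X + 1` has no root in `ℚ_p` for `p = 2`: a root is a 2-adic integer (ultrametric), and `X² + X + 1` has no
root in `ℤ/2`. -/
theorem not_exists_root_padic (p : ℕ) [hp : Fact p.Prime] (h2 : p = 2) :
    ¬ ∃ y : ℚ_[p], y ^ 2 + y + 1 = 0 := by
  subst h2
  rintro ⟨y, hy⟩
  have hnorm : ‖y‖ ≤ 1 := by
    by_contra hlt
    have hlt' : 1 < ‖y‖ := lt_of_not_ge hlt
    have hsq : y ^ 2 = -(y + 1) := by linear_combination hy
    have h1 : ‖y‖ ^ 2 = ‖y + 1‖ := by rw [← norm_pow, hsq, norm_neg]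
    have h2 : ‖y + 1‖ ≤ max ‖y‖ ‖(1 : ℚ_[2])‖ := Padic.nonarchimedean y 1
    rw [norm_one, max_eq_left hlt'.le] at h2
    nlinarith
  set z : ℤ_[2] := ⟨y, hnorm⟩ with hz
  have hz2 : z ^ 2 + z + 1 = 0 := by
    apply Subtype.ext
    simp [hz, hy]
  have hmod := congrArg (PadicInt.toZMod (p := 2)) hz2
  rw [map_add, map_add, map_pow, map_one, map_zero] at hmod
  exact zmod_two_no_root _ hmod

/-- `X² + X + 1` has no root in `ℚ_{v₂}`. -/
theorem not_exists_root : ¬ ∃ y : v₂.adicCompletion ℚ, y ^ 2 + y + 1 = 0 := by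
  rintro ⟨y, hy⟩
  haveI : Fact (Nat.Prime ((Rat.HeightOneSpectrum.primesEquiv (R := NumberField.RingOfIntegers ℚ) v₂ :
      Nat.Primes) : ℕ)) := ⟨(Rat.HeightOneSpectrum.primesEquiv v₂).2⟩
  apply not_exists_root_padic _ primesEquiv_v₂_val
  refine ⟨Rat.HeightOneSpectrum.adicCompletion.padicEquiv v₂ y, ?_⟩
  rw [← map_one (Rat.HeightOneSpectrum.adicCompletion.padicEquiv v₂), ← map_pow, ← map_add, ← map_add, hy, map_zero]

/-- A 2-adic integer `z` with `2 ∣ z² + z + 1` does not exist (`ℤ/2`). -/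
theorem not_dvd_sq_add_self_add_one (p : ℕ) [hp : Fact p.Prime] (h2 : p = 2) (z : ℤ_[p]) :
    ¬ (2 : ℤ_[p]) ∣ z ^ 2 + z + 1 := by
  subst h2
  rintro ⟨d, hd⟩
  have hmod := congrArg (PadicInt.toZMod (p := 2)) hd
  rw [map_add, map_add, map_pow, map_one, map_mul, map_ofNat] at hmod
  exact zmod_two_no_root' _ _ hmod

/-! ### A place `w` of `ℚ(ζ₃)` above `2` -/

/-- Some place `w` of `ℚ(ζ₃)` lies over `v₂`. -/
theorem exists_liesOver : ∃ w : HeightOneSpectrum (NumberField.RingOfIntegers L₃), w.asIdeal.LiesOver v₂.asIdeal := by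
  haveI : v₂.asIdeal.IsMaximal := v₂.isMaximal
  obtain ⟨Q, hQmax, hQ⟩ := Ideal.exists_ideal_over_maximal_of_isIntegral
    (S := NumberField.RingOfIntegers L₃) v₂.asIdeal
    (by
      rw [(RingHom.injective_iff_ker_eq_bot (algebraMap (NumberField.RingOfIntegers ℚ)
        (NumberField.RingOfIntegers L₃))).mp (FaithfulSMul.algebraMap_injective _ _)]
      exact bot_le)
  haveI := hQmax
  refine ⟨⟨Q, hQmax.isPrime, ?_⟩, ⟨?_⟩⟩
  · rintro rfl
    rw [Ideal.comap_bot_of_injective _ (FaithfulSMul.algebraMap_injective _ _)] at hQ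
    exact v₂.ne_bot hQ.symm
  · exact hQ.symm

variable (w : HeightOneSpectrum (NumberField.RingOfIntegers L₃)) [w.asIdeal.LiesOver v₂.asIdeal]

omit [w.asIdeal.LiesOver v₂.asIdeal] in
/-- The image of `ω` in `L_w` satisfies `x² + x + 1 = 0`. -/
theorem omega_completion_root :
    (algebraMap L₃ (w.adicCompletion L₃) ω) ^ 2 + algebraMap L₃ (w.adicCompletion L₃) ω + 1 = 0 := by
  rw [← map_one (algebraMap L₃ (w.adicCompletion L₃)), ← map_pow, ← map_add, ← map_add,
    omega_sq_add_omega_add_one, map_zero]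

/-- The image of `ω` is not in the image of `K_v`. -/
theorem omega_notMem_range :
    algebraMap L₃ (w.adicCompletion L₃) ω ∉
      Set.range (algebraMap (v₂.adicCompletion ℚ) (w.adicCompletion L₃)) := by
  rintro ⟨y, hy⟩
  apply not_exists_root
  refine ⟨y, (algebraMap (v₂.adicCompletion ℚ) (w.adicCompletion L₃)).injective ?_⟩
  rw [map_add, map_add, map_pow, map_one, map_zero, hy]
  exact omega_completion_root w

/-- `[L_w : K_v] = 2`. -/
theorem finrank_eq_two :
    Module.finrank (v₂.adicCompletion ℚ) (w.adicCompletion L₃) = 2 :=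
  T5CompletionDegree.finrank_eq_two v₂ w T5EisensteinField.finrank_eq_two (omega_notMem_range w)

/-- The image of `ω` in `O_{L_w}`. -/
noncomputable def ωw : w.adicCompletionIntegers L₃ :=
  algebraMap (NumberField.RingOfIntegers L₃) (w.adicCompletionIntegers L₃) ωO

omit [w.asIdeal.LiesOver v₂.asIdeal] in
/-- `ω_w² + ω_w + 1 = 0` in `L_w`. -/
theorem omegaw_sq_add_omegaw_add_one :
    (ωw w : w.adicCompletion L₃) ^ 2 + (ωw w : w.adicCompletion L₃) + 1 = 0 := by
  unfold ωw
  have : ((algebraMap (NumberField.RingOfIntegers L₃) (w.adicCompletionIntegers L₃) ωO : w.adicCompletionIntegers L₃) :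
      w.adicCompletion L₃) = algebraMap L₃ (w.adicCompletion L₃) ω := rfl
  rw [this]
  exact omega_completion_root w

/-! ### THE PLACE IS INERT -/

/-- `ϖ = 2` STAYS IRREDUCIBLE IN `O_{L_w}`: the place `w ∣ 2` of `ℚ(ζ₃)` is inert. -/
theorem irreducible_algebraMap_two :
    Irreducible (algebraMap (v₂.adicCompletionIntegers ℚ) (w.adicCompletionIntegers L₃)
      (2 : v₂.adicCompletionIntegers ℚ)) := by
  by_contra hram
  obtain ⟨π₀, hπ₀⟩ := Summit.Ventures.HodgeRepro2.T5LocalNormIndex.exists_irreducible_adicCompletionIntegers w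
  have h2 := finrank_eq_two w
  have hϖ := Summit.Ventures.HodgeRepro2.T5GaussianPlace.irreducible_two
  -- the integral basis `(1, π₀)`: `ω = a + b π₀` with `a, b ∈ O_{K_v}`
  obtain ⟨a, b, ha, hb, hω⟩ :=
    Summit.Ventures.HodgeRepro2.T5RamifiedIntegralBasis.exists_eq_algebraMap_add_algebraMap_mul_uniformizer_of_val_le_one
      v₂ w h2 hϖ hπ₀ hram (y := (ωw w : w.adicCompletion L₃))
      ((IsDedekindDomain.HeightOneSpectrum.mem_adicCompletionIntegers (NumberField.RingOfIntegers L₃) L₃ w).mp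
        (ωw w).2)
  have hsq := Summit.Ventures.HodgeRepro2.T5RamifiedNormTransfer.val_algebraMap_eq_sq v₂ w h2 hϖ hπ₀ hram
  -- `alg (a² + a + 1) = −π₀ · (2ab + b + b² π₀)`
  have hrel : algebraMap (v₂.adicCompletion ℚ) (w.adicCompletion L₃) (a ^ 2 + a + 1) =
      -((π₀ : w.adicCompletion L₃) *
        (algebraMap (v₂.adicCompletion ℚ) (w.adicCompletion L₃) (2 * a * b + b) +
          algebraMap (v₂.adicCompletion ℚ) (w.adicCompletion L₃) (b ^ 2) * (π₀ : w.adicCompletion L₃))) := by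
    have h0 := omegaw_sq_add_omegaw_add_one w
    rw [hω] at h0
    simp only [map_add, map_mul, map_pow, map_one, map_ofNat]
    linear_combination h0
  -- the valuation of the right-hand side is `< 1`
  have hπ₀v : Valued.v (π₀ : w.adicCompletion L₃) = WithZero.exp (-1) :=
    (Summit.Ventures.HodgeRepro2.T5AdicCompletionConductor.irreducible_iff_val_eq_exp_neg_one w π₀).mp hπ₀
  have hint : Valued.v (algebraMap (v₂.adicCompletion ℚ) (w.adicCompletion L₃) (2 * a * b + b) +
      algebraMap (v₂.adicCompletion ℚ) (w.adicCompletion L₃) (b ^ 2) * (π₀ : w.adicCompletion L₃)) ≤ 1 := by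
    have h2v : Valued.v (2 : v₂.adicCompletion ℚ) ≤ 1 := by
      rw [Summit.Ventures.HodgeRepro2.T5GaussianPlace.val_two]
      exact (WithZero.exp_le_exp.mpr (by norm_num : (-1 : ℤ) ≤ 0)).trans_eq WithZero.exp_zero
    have hsum : Valued.v (2 * a * b + b) ≤ 1 := by
      refine (Valuation.map_add _ _ _).trans (max_le ?_ hb)
      rw [map_mul, map_mul]
      exact mul_le_one' (mul_le_one' h2v ha) hb
    refine (Valuation.map_add _ _ _).trans (max_le ?_ ?_)
    · rw [hsq]
      exact pow_le_one₀ zero_le hsum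
    · rw [map_mul, hsq, map_pow, hπ₀v]
      exact mul_le_one' (pow_le_one₀ zero_le (pow_le_one₀ zero_le hb))
        ((WithZero.exp_le_exp.mpr (by norm_num : (-1 : ℤ) ≤ 0)).trans_eq WithZero.exp_zero)
  have hlt : Valued.v (algebraMap (v₂.adicCompletion ℚ) (w.adicCompletion L₃) (a ^ 2 + a + 1)) < 1 := by
    rw [hrel, Valuation.map_neg, map_mul, hπ₀v]
    calc WithZero.exp (-1) * Valued.v (algebraMap (v₂.adicCompletion ℚ) (w.adicCompletion L₃) (2 * a * b + b) +
          algebraMap (v₂.adicCompletion ℚ) (w.adicCompletion L₃) (b ^ 2) * (π₀ : w.adicCompletion L₃))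
        ≤ WithZero.exp (-1) * 1 := mul_le_mul_right hint _
      _ < 1 := by
          rw [mul_one, ← WithZero.exp_zero]
          exact WithZero.exp_lt_exp.mpr (by norm_num)
  -- hence `v(a² + a + 1) < 1` in `K_v`
  have hc : Valued.v (a ^ 2 + a + 1) < 1 := by
    rw [hsq] at hlt
    by_contra hge
    have hge' : 1 ≤ Valued.v (a ^ 2 + a + 1) := le_of_not_gt hge
    exact absurd hlt (not_lt.mpr (one_le_pow₀ hge'))
  -- `a` and `c := a² + a + 1` as elements of `O_{K_v}`; `2 ∣ c`
  have hcint : Valued.v (a ^ 2 + a + 1) ≤ 1 := hc.le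
  set a' : v₂.adicCompletionIntegers ℚ :=
    ⟨a, (IsDedekindDomain.HeightOneSpectrum.mem_adicCompletionIntegers (NumberField.RingOfIntegers ℚ) ℚ v₂).mpr ha⟩
    with ha'
  set c' : v₂.adicCompletionIntegers ℚ :=
    ⟨a ^ 2 + a + 1, (IsDedekindDomain.HeightOneSpectrum.mem_adicCompletionIntegers (NumberField.RingOfIntegers ℚ) ℚ
      v₂).mpr hcint⟩ with hc'
  have hc'eq : c' = a' ^ 2 + a' + 1 := by
    apply Subtype.ext
    simp [hc', ha']
  have hnotunit : ¬ IsUnit c' := by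
    rw [IsDedekindDomain.HeightOneSpectrum.adicCompletionIntegers.isUnit_iff_valued_eq_one]
    exact ne_of_lt hc
  have hmem : c' ∈ IsLocalRing.maximalIdeal (v₂.adicCompletionIntegers ℚ) :=
    (IsLocalRing.mem_maximalIdeal c').mpr hnotunit
  rw [hϖ.maximalIdeal_eq, Ideal.mem_span_singleton] at hmem
  -- transport to `ℤ₂`
  haveI : Fact (Nat.Prime ((Rat.HeightOneSpectrum.primesEquiv (R := NumberField.RingOfIntegers ℚ) v₂ :
      Nat.Primes) : ℕ)) := ⟨(Rat.HeightOneSpectrum.primesEquiv v₂).2⟩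
  apply not_dvd_sq_add_self_add_one _ primesEquiv_v₂_val
    (Rat.HeightOneSpectrum.adicCompletionIntegers.padicIntEquiv v₂ a')
  have hmap := map_dvd (Rat.HeightOneSpectrum.adicCompletionIntegers.padicIntEquiv v₂) hmem
  rw [map_ofNat, hc'eq, map_add, map_add, map_pow, map_one] at hmap
  exact hmap

/-- There is a non-trivial `K_v`-automorphism of `L_w`. -/
theorem exists_algEquiv_ne_one :
    ∃ σ : (w.adicCompletion L₃) ≃ₐ[v₂.adicCompletion ℚ] (w.adicCompletion L₃), σ ≠ 1 :=
  Summit.Ventures.HodgeRepro2.T5AdicCompletionConjugation.exists_algEquiv_ne_one v₂ w (finrank_eq_two w)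

/-- The index hypothesis holds: `[K_v^× : N L_w^×] = 2`. -/
theorem index_normGroup_eq_two (σ : (w.adicCompletion L₃) ≃ₐ[v₂.adicCompletion ℚ] (w.adicCompletion L₃))
    (hσ : σ ≠ 1) : (Summit.Ventures.HodgeRepro2.T5AdicCompletionNormGroup.normGroup v₂ w σ).index = 2 :=
  Summit.Ventures.HodgeRepro2.T5LocalNormIndex.index_normGroup_eq_two v₂ w σ (finrank_eq_two w) hσ

/-- THE CONDUCTOR EXPONENT OF THE NORM CHARACTER OF THE INERT PLACE IS `0`: every unit of `O_{K_v}` is a norm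
(row 138), so `U^{(0)} ⊆ ker η_v`. -/
theorem normCharConductor_eq_zero (σ : (w.adicCompletion L₃) ≃ₐ[v₂.adicCompletion ℚ] (w.adicCompletion L₃))
    (hσ : σ ≠ 1) (hind : (Summit.Ventures.HodgeRepro2.T5AdicCompletionNormGroup.normGroup v₂ w σ).index = 2) :
    Summit.Ventures.HodgeRepro2.T5NormCharConductor.normCharConductor v₂ w σ
      (2 : v₂.adicCompletionIntegers ℚ) hind = 0 := by
  apply Nat.le_zero.mp
  apply Summit.Ventures.HodgeRepro2.T5NormCharConductor.normCharConductor_le_of_le_ker v₂ w σ 2 hind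
  intro y hy
  rw [MonoidHom.mem_ker, Summit.Ventures.HodgeRepro2.T5LocalNormCharacter.normChar_eq_one_iff]
  exact Summit.Ventures.HodgeRepro2.T5AdicCompletionNormGroup.mem_normGroup_of_val_eq_one v₂ w σ (finrank_eq_two w)
    Summit.Ventures.HodgeRepro2.T5GaussianPlace.irreducible_two (irreducible_algebraMap_two w) hσ
    ((Summit.Ventures.HodgeRepro2.T5NormCharConductor.mem_unitFiltration_zero_iff v₂ 2 y).mp hy)

/-- THE HYPOTHESIS SET OF THE INERT FILES IS SATISFIABLE (README §10.5(ii)(c)/(d) witness): at `ℚ(ζ₃)/ℚ` and any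
`w ∣ 2`, `[L_w : K_v] = 2`, `ϖ = 2` is a uniformiser of `O_{K_v}` that STAYS irreducible in `O_{L_w}`, and
`Gal(L_w/K_v)` has a non-trivial element. -/
theorem hypotheses_satisfiable :
    Module.finrank (v₂.adicCompletion ℚ) (w.adicCompletion L₃) = 2 ∧
    ∃ ϖ : v₂.adicCompletionIntegers ℚ, Irreducible ϖ ∧
      Irreducible (algebraMap (v₂.adicCompletionIntegers ℚ) (w.adicCompletionIntegers L₃) ϖ) ∧
      ∃ σ : (w.adicCompletion L₃) ≃ₐ[v₂.adicCompletion ℚ] (w.adicCompletion L₃), σ ≠ 1 :=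
  ⟨finrank_eq_two w, 2, Summit.Ventures.HodgeRepro2.T5GaussianPlace.irreducible_two,
    irreducible_algebraMap_two w, exists_algEquiv_ne_one w⟩

end Summit.Ventures.HodgeRepro2.T5EisensteinInertPlace
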